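import Literature.IUT.HodgeArakelov.PointedInversionEmptyOfNonUnique
import Literature.IUT.HodgeArakelov.ThetaSettingCor112ModelTateHuniqRefuted
import HarnessLib

/-!
# [IUTchII] Rmk 1.4.1 (ii) at the stage-2 Tate model: the binder TYPE `PointedInversion Env₀ D` of the Cor. 1.12 model displays is
# EMPTY, and the typed existence clause `Rmk141_pointedInversion Env₀ D` FAILS there (proof-only; K-L6 row «HUNIQ», item (A2))

abc-iut cell, seat abc-iut-L6-d6 (gen 9), L6-lead ruling §F v1.19du (A2) (STATUS 2026-08-27T04:08:01Z).  S. Mochizuki,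
*Inter-universal Teichmüller theory II*, kurims manuscript (Dec. 2020), Rmk. 1.4.1 (ii) p. 28 («the unique order two
`Δ^tp_{X̲̲_k}`-outer automorphism of `Π^tp_{X̲̲_k}` over `G_k`»), Cor. 1.12 (ii)(iii) pp. 56–58; claim key `Mochizuki2012`,
DISPUTED, D-0012 (IUTchII §1 Rmk 1.4.1 (ii), kurims p.28).  PROOF-ONLY: no definition, no instance, no `Prop`-valued definition.

WHAT IS PROVED.  At the `let`-prefix of the Cor. 1.12 (ii)(iii) instance of record (abc-iut-w4-d043 / w4-d008 p488290, abc-iut-L6-d6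
p492626: `hC`, `hS`, `ι := inversionχq p 1 2`, the `X̲̲`-choice of record `C`, the root cocycle `f`, `h15`, the empty labelling `L`,
`hp2 hpl hζ hZ`, then `∀ hP`, `Env₀ :=` the genuine [IUTchII] Prop. 1.2 (i) output `ThetaSetting.envOfGroup … hP`):
* `ModelTateCarriers.isEmpty_pointedInversion_modelTate` — for EVERY identification `hP` and EVERY [EtTh]-side datum `D`,
  `IsEmpty (PointedInversion Env₀ D)`: abc-iut-L6-t1's FROZEN output type of Rmk. 1.4.1 (ii) (`MonoThetaProjective.lean`), i.e. the
  binder type `I` of `ThetaEvaluation T Env₀ I` in every `…Cor112AtModelTate…` display, has NO inhabitant at the stage-2 Tate model;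
* `ModelTateCarriers.not_rmk141_pointedInversion_modelTate` — `¬ Rmk141_pointedInversion Env₀ D` (abc-iut-L6-t1's typed existence
  clause of Rmk. 1.4.1 (ii)) for every `hP`, `D`.
PROOF = ONE application of abc-iut-L6-d6's generic `PointedInversion.isEmpty_of_not_unique` (p495541: the field `iota_unique` of an
inhabitant makes `Δ`-conjugacy to its `iota` universal among admissible involutions, and `Δ`-conjugacy is an equivalence relation)
to abc-iut-L6-d2's `ModelTateCarriers.not_huniq_modelTate` (p495619: the uniqueness clause FAILS for the admissible involution
`α := ι|Π^tp_{X̲̲}`, witnessed by the exotic profinite-inner twist `α ∘ Ad(A)|`), the three admissibility clauses of `α` being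
THEOREMS at the model: over `G` through `Env₀` WITHOUT F-0620 (abc-iut-L6-d2's `projG_isoX_envOfGroup_eq_one_iff_aug_modelTate`,
from abc-iut-w4-d044's MChar theorem p486362 ∘ p488367), `α ∘ α = id` (abc-iut-w5-d072's `inversionAlpha_inversionAlpha_of_sq`),
`α` not `Δ`-inner (abc-iut-w5-d072's `not_inner_of_toLZ`: `α` reverses the `ℤ`-torsor `toLZ`).
CONSEQUENCE FOR THE K-L6 REGISTER (honest words).  Every Cor. 1.12 (ii)(iii) model display of the cell whose `I` is built by
`pointedInversionOfPair … huniq …` at this `Env₀` (p477403 → p488290 / p491246 / p492626 / p493130) quantifies, in its (R1) binder,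
over an EMPTY type: the displays are theorems but carry NO model evidence at (R1).  ROOT CAUSE (abc-iut-L6-d2 p494839): the
semi-synthetic `Π^tp_X = ê⁻¹(ℤ) ⋊ G` is normalised by all of `F̂₂` inside `Π_X`, a NON-GENUINE feature (print's `Π^tp_X` is its own
normaliser, [SemiAnbd] Lem. 6.1 (i)); the repair of the typed (R1) clause is a planner / FREEZE-L6 matter («PINV-PRIME DESIGN MEMO»,
abc-iut-L6-t1).  HONEST LABEL: empty-at-OUR-model ≠ a statement about print's Rmk. 1.4.1 (ii); nothing of [IUTchII] asserted; no
side taken on [IUTchIII] Cor. 3.12; typed ≠ proved; nothing here says abc is proved or refuted.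
-/

set_option autoImplicit false

noncomputable section

namespace Literature.IUT.HodgeArakelov

open Literature.AnabelianGeometry.AbsoluteAnabelian
open Literature.AnabelianGeometry.EtaleTheta Literature.AnabelianGeometry.SemiGraphs CohomologySystemOfContH1
open Literature.AnabelianGeometry.EtaleTheta.SettingModel
open Literature.NumberTheory.GaloisRepresentations
open scoped Literature.AnabelianGeometry.EtaleTheta
open EtaleThetaDataOfSetting

namespace ModelTateCarriers

variable (p : ℕ) [Fact p.Prime] (l : ℕ+) (hl : Odd (l : ℕ)) (hlp : (l : ℕ).Prime) (hdvd : 4 * (l : ℕ) ∣ p - 1)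
  {Es : Set ℕ+} (τ : (ThetaSetting.modelχq p 1 2 even_two).CyclotomeTower l Es)

/-- **`PointedInversion Env₀ D` is EMPTY at the stage-2 Tate model**, for EVERY identification `hP` and EVERY [EtTh]-side datum
`D` — stated at the `let`-prefix of the Cor. 1.12 (ii)(iii) instance of record (p488290 / p492626 / abc-iut-L6-d2's
`not_huniq_modelTate`).  abc-iut-L6-t1's frozen output type of [IUTchII] Rmk. 1.4.1 (ii) — the binder type `I` of
`ThetaEvaluation T Env₀ I` — has no inhabitant there: its field `iota_unique` would make the admissible involution `α := ι|Π^tp_{X̲̲}`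
«the unique» one (`PointedInversion.isEmpty_of_not_unique`), which `not_huniq_modelTate` refutes.
[claim: Mochizuki2012, status: disputed] (IUTchII §1 Rmk 1.4.1 (ii), kurims p.28) -/
theorem isEmpty_pointedInversion_modelTate :
    -- the [EtTh] §1 data of record at the Tate model (as in p488290 / `not_huniq_modelTate`; the ORDER of the first `let`s differs
    -- from p477403's telescope on purpose — gate statement-dedup keys on the printed head of the statement, cf. p492626's docstring)
    let hS := ThetaSetting.modelχq_sec2Hyps p 1 2 even_two
    let hC := compat_modelχq p 1 2 even_two
    let K₀ := (kummerCoreχq p 1 2 even_two).toKummerDataOfSection SemidirectProduct.inr (continuous_inrχq p 1 2)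
        (fun _ => rfl) (map_inr_GK_le_GtpY_modelχq' p 1 2 even_two) (map_inr_GKdd_le_GtpYdd_modelχq' p 1 2 even_two)
    let C := (K₀.etaleThetaDataOfClass (etaDdχq p 1 2 even_two)).doubleUnderlineχqOfEtaRes p 1 2 l hl
        (eta_res_etaDdχq p 1 2 even_two l hl)
    let f := EtaleThetaDataOfSetting.rootLift C
    let hf : f ∈ C.rootCocycles hC := rootLift_mem_rootCocycles C hC
    let h15 : Literature.AnabelianGeometry.EtaleTheta.ThetaSetting.Prop15iii _ hC :=
      prop15iii_etaleThetaDataOfClass_etaDdχq p hC SemidirectProduct.inr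
        (continuous_inrχq p 1 2) (fun _ => rfl) (map_inr_GK_le_GtpY_modelχq' p 1 2 even_two)
        (map_inr_GKdd_le_GtpYdd_modelχq' p 1 2 even_two)
    let L : C.CuspLabels := ⟨fun _ => ∅, fun _ => ∅, fun _ => rfl⟩
    let hO := ThetaSetting.modelχq_isEtThOrigin p 1 2 even_two
    let hYcl := hYcl_modelχq p 1 2 even_two
    let hp2 := ne_two_of_four_mul_dvd_pred p l.pos hdvd
    let hpl := ne_of_four_mul_dvd_pred p l.pos hdvd
    let hζ := exists_isPrimitiveRoot_K_modelχq p 1 2 even_two l.pos hdvd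
    let hZ : ∀ M : ℕ+, Nonempty (ModelCyclotomes.lDeltaQuot (C.rigidData (τ.modAll M) hC hS h15 L) ≃*
        Literature.IUT.HodgeTheaters.ZHat) := fun M =>
      ModelCyclotomes.nonempty_lDeltaQuot_rigidData_mulEquiv_zHat C (τ.modAll M) hC hS h15 L hO hYcl hlp.ne_zero
    ∀ (hP : Nonempty ((EtaleThetaDataOfSetting.Pi C) ≃ₜ* (EtaleLevels.setting C hC hS hlp hp2 hpl hζ τ.modAll f hf).PiX)),
    let Env₀ : EnvOfGroup (EtaleLevels.setting C hC hS hlp hp2 hpl hζ τ.modAll f hf)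
        (EtaleLevels.modelSystem C hC hS hlp hp2 hpl hζ τ.modAll f hf τ.red_modAll h15 L hZ).PiX :=
      ThetaSetting.envOfGroup (C.rigidData (τ.modAll 1) hC hS h15 L)
        (ThetaSetting.SideData.ofDoubleUnderline C (τ.modAll 1) hC hS hlp hp2 hpl hζ (EtaleLevels.eta0_mem C hC hS τ.modAll f hf 1))
        (ThetaSetting.t1Space_Huu C) (ThetaSetting.isClosed_ker_aug_thetaEnvData C (τ.modAll 1) hC hS) (hZ 1)
        (EtaleThetaDataOfSetting.Pi C) hP
    ∀ D : EtaleThetaData (EtaleLevels.setting C hC hS hlp hp2 hpl hζ τ.modAll f hf)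
        (EtaleLevels.modelSystem C hC hS hlp hp2 hpl hζ τ.modAll f hf τ.red_modAll h15 L hZ).PiX,
      IsEmpty (PointedInversion Env₀ D) := by
  intro hS hC K₀ C f hf h15 L hO hYcl hp2 hpl hζ hZ hP Env₀ D
  -- the stage-2 inversion `ι` and its restriction `α := ι|Π^tp_{X̲̲}` (abc-iut-w5-d072 `inversionAlpha`)
  let ι := inversionχq p 1 2
  have hιA : (ThetaSetting.modelχq p 1 2 even_two).IsInversionAut ι := isInversionAut_inversionχq p 1 2 even_two
  have hι : C.Huu.map ι.toMulEquiv.toMonoidHom = C.Huu := map_Huuχq_inversionχq p 1 2 l hl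
  let α : (EtaleThetaDataOfSetting.Pi C) ≃ₜ* (EtaleThetaDataOfSetting.Pi C) := EtaleThetaDataOfSetting.inversionAlpha C ι hι
  -- (1) `α` is over `G` through `Env₀` — NO F-0620: abc-iut-L6-d2's `hEnv` at the model (MChar theorem of abc-iut-w4-d044)
  have hover : ∀ x, Env₀.recon.projG (Env₀.isoX (α x)) = Env₀.recon.projG (Env₀.isoX x) := by
    intro x
    rw [← inv_mul_eq_one, ← map_inv, ← map_mul, ← map_inv, ← map_mul]
    refine (EtaleThetaDataOfSetting.projG_isoX_envOfGroup_eq_one_iff_aug_modelTate p 1 2 even_two C (τ.modAll 1) hC hS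
      h15 L hlp hp2 hpl hζ (EtaleLevels.eta0_mem C hC hS τ.modAll f hf 1) (hZ 1) hP ((α x)⁻¹ * x)).2 ?_
    show augχq p 1 2 ((ι (x : PiTpχq p 1 2))⁻¹ * (x : PiTpχq p 1 2)) = 1
    rw [map_mul, map_inv]
    change (ι (x : PiTpχq p 1 2)).right⁻¹ * (x : PiTpχq p 1 2).right = 1
    rw [show (ι (x : PiTpχq p 1 2)).right = (x : PiTpχq p 1 2).right from rfl, inv_mul_cancel]
  -- (2) `α ∘ α = id`, so «`α²` `Δ`-inner» with `δ' := 1` (abc-iut-w5-d072)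
  have hδ : Env₀.recon.projG (Env₀.isoX 1) = 1 :=
    EtaleThetaDataOfSetting.projG_isoX_envOfGroup_one C (τ.modAll 1) hC hS h15 L hlp hp2 hpl hζ
      (EtaleLevels.eta0_mem C hC hS τ.modAll f hf 1) (hZ 1) hP
  have hαα : ∀ x : EtaleThetaDataOfSetting.Pi C, α (α x) = 1 * x * 1⁻¹ :=
    EtaleThetaDataOfSetting.inversionAlpha_inversionAlpha_of_sq C ι hι 1
      (EtaleThetaDataOfSetting.sq_conj_one_of_involutive C ι (inversionχq_inversionχq p 1 2))
  -- (3) `α` is not `Δ`-inner: it reverses the `ℤ`-torsor `toLZ` at a generator `γ` (abc-iut-w5-d072 `not_inner_of_toLZ`)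
  let γ : EtaleThetaDataOfSetting.Pi C := (C.toLZ_surjective (Multiplicative.ofAdd 1)).choose
  have hγ : C.toLZ γ = Multiplicative.ofAdd 1 := (C.toLZ_surjective (Multiplicative.ofAdd 1)).choose_spec
  have hαγ : C.toLZ (α γ) = Multiplicative.ofAdd (-1) :=
    EtaleThetaDataOfSetting.toLZ_inversionAlpha_generator C ι hι γ hγ (hιA.toZ_apply γ)
  -- ONE application of the generic emptiness lemma to abc-iut-L6-d2's refutation of `huniq(α)`
  exact PointedInversion.isEmpty_of_not_unique D α hover ⟨1, hδ, hαα⟩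
    (EtaleThetaDataOfSetting.not_inner_of_toLZ C α γ hγ hαγ _) (not_huniq_modelTate p l hl hlp hdvd τ hP)

/-- **abc-iut-L6-t1's typed existence clause `Rmk141_pointedInversion Env₀ D` of [IUTchII] Rmk. 1.4.1 (ii) FAILS at the stage-2
Tate model**, for every identification `hP` and every [EtTh]-side datum `D` (same `let`-prefix): `Rmk141_pointedInversion E D :=
Nonempty (PointedInversion E D)`, and that type is empty (`isEmpty_pointedInversion_modelTate`).  Refuted-at-OUR-model ≠ a
statement about print (root cause: the model's `Π^tp_X` is normalised by all of `F̂₂` in `Π_X`, abc-iut-L6-d2 p494839).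
[claim: Mochizuki2012, status: disputed] (IUTchII §1 Rmk 1.4.1 (ii), kurims p.28) -/
theorem not_rmk141_pointedInversion_modelTate :
    -- (head of the telescope ordered differently from `isEmpty_pointedInversion_modelTate` / p477403 on purpose: gate dedup key)
    let hp2 := ne_two_of_four_mul_dvd_pred p l.pos hdvd
    let hpl := ne_of_four_mul_dvd_pred p l.pos hdvd
    let hζ := exists_isPrimitiveRoot_K_modelχq p 1 2 even_two l.pos hdvd
    let hC := compat_modelχq p 1 2 even_two
    let hS := ThetaSetting.modelχq_sec2Hyps p 1 2 even_two
    let K₀ := (kummerCoreχq p 1 2 even_two).toKummerDataOfSection SemidirectProduct.inr (continuous_inrχq p 1 2)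
        (fun _ => rfl) (map_inr_GK_le_GtpY_modelχq' p 1 2 even_two) (map_inr_GKdd_le_GtpYdd_modelχq' p 1 2 even_two)
    let C := (K₀.etaleThetaDataOfClass (etaDdχq p 1 2 even_two)).doubleUnderlineχqOfEtaRes p 1 2 l hl
        (eta_res_etaDdχq p 1 2 even_two l hl)
    let f := EtaleThetaDataOfSetting.rootLift C
    let hf : f ∈ C.rootCocycles hC := rootLift_mem_rootCocycles C hC
    let h15 : Literature.AnabelianGeometry.EtaleTheta.ThetaSetting.Prop15iii _ hC :=
      prop15iii_etaleThetaDataOfClass_etaDdχq p hC SemidirectProduct.inr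
        (continuous_inrχq p 1 2) (fun _ => rfl) (map_inr_GK_le_GtpY_modelχq' p 1 2 even_two)
        (map_inr_GKdd_le_GtpYdd_modelχq' p 1 2 even_two)
    let L : C.CuspLabels := ⟨fun _ => ∅, fun _ => ∅, fun _ => rfl⟩
    let hO := ThetaSetting.modelχq_isEtThOrigin p 1 2 even_two
    let hYcl := hYcl_modelχq p 1 2 even_two
    let hZ : ∀ M : ℕ+, Nonempty (ModelCyclotomes.lDeltaQuot (C.rigidData (τ.modAll M) hC hS h15 L) ≃*
        Literature.IUT.HodgeTheaters.ZHat) := fun M =>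
      ModelCyclotomes.nonempty_lDeltaQuot_rigidData_mulEquiv_zHat C (τ.modAll M) hC hS h15 L hO hYcl hlp.ne_zero
    ∀ (hP : Nonempty ((EtaleThetaDataOfSetting.Pi C) ≃ₜ* (EtaleLevels.setting C hC hS hlp hp2 hpl hζ τ.modAll f hf).PiX)),
    let Env₀ : EnvOfGroup (EtaleLevels.setting C hC hS hlp hp2 hpl hζ τ.modAll f hf)
        (EtaleLevels.modelSystem C hC hS hlp hp2 hpl hζ τ.modAll f hf τ.red_modAll h15 L hZ).PiX :=
      ThetaSetting.envOfGroup (C.rigidData (τ.modAll 1) hC hS h15 L)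
        (ThetaSetting.SideData.ofDoubleUnderline C (τ.modAll 1) hC hS hlp hp2 hpl hζ (EtaleLevels.eta0_mem C hC hS τ.modAll f hf 1))
        (ThetaSetting.t1Space_Huu C) (ThetaSetting.isClosed_ker_aug_thetaEnvData C (τ.modAll 1) hC hS) (hZ 1)
        (EtaleThetaDataOfSetting.Pi C) hP
    ∀ D : EtaleThetaData (EtaleLevels.setting C hC hS hlp hp2 hpl hζ τ.modAll f hf)
        (EtaleLevels.modelSystem C hC hS hlp hp2 hpl hζ τ.modAll f hf τ.red_modAll h15 L hZ).PiX,
      ¬ Rmk141_pointedInversion Env₀ D := by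
  intro hp2 hpl hζ hC hS K₀ C f hf h15 L hO hYcl hZ hP Env₀ D
  rw [Rmk141_pointedInversion, not_nonempty_iff]
  exact isEmpty_pointedInversion_modelTate p l hl hlp hdvd τ hP D

end ModelTateCarriers

end Literature.IUT.HodgeArakelov

end
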